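import Literature.Geometry.Kaehler.ComplexTorusPicardNumberFiniteProduct
import Literature.Geometry.Kaehler.ComplexTorusPicardNumberEllipticPower
import HarnessLib

/-!
# The first gap in the Picard numbers of abelian varieties isogenous to a product of elliptic curves:
# `ρ = g²` or `ρ ≤ (g−1)² + 1` for `g ≥ 4` (Hulek–Laface 2019, Thm. 1.1 (1), §3.2 cases (a) and (b), `m = 1`)

Layer `Literature/Geometry/Kaehler`, namespace `Literature.Geometry.Kaehler.ComplexTorus`; lane
`lit-hodgefound`, Layer A4 (row A4-13, the Picard number), seat p18, self-proposed sequel row g5-#3 of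
`ComplexTorusPicardNumberProduct.lean` (g5-#1: `ρ(X₁ × X₂) = ρ(X₁) + ρ(X₂) + rk Hom`, the two-block bound
`IsIsogenous.finrank_neronSeveriGroup_le_sq_pred_add_one`) and `ComplexTorusPicardNumberFiniteProduct.lean`
(g5-#2: the finite product torus `piPeriod`, `homRat_pi_left/right_eq_bot_iff`). THEOREMS ONLY (no
definitions, no named facts).

Source followed: K. Hulek, R. Laface, *On the Picard numbers of abelian varieties*, Ann. Sc. Norm. Super.
Pisa Cl. Sci. (5) XIX (2019), 1199–1224 [arXiv:1703.05882], held copy `paper:arxiv-1703.05882`. Quoted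
(p0002, p0007):

* "**Theorem 1.1.** Let `g` be a positive integer. (1) If `g ≥ 4`, there does not exist any abelian
  variety of dimension `g` with Picard number `ρ` in the range `(g−1)² + 1 < ρ < g²`."
* §3.2 "Proof of part (1). Let `A` be an abelian variety of dimension `g ≥ 4` … (a) `A` has length at
  least two, i.e. `r(A) ≥ 2`; (b) `A` is a self-product of a lower dimensional abelian variety.
  Case (a). Since `r(A) ≥ 2`, we have that `A ∼ A_1 × A_2` with `Hom(A_1, A_2) = 0`. Let `n := dim A_1`,
  so that `dim A_2 = g − n`. Then, `ρ(A) ≤ n² + (g−n)²`. … Therefore, `ρ(A) ≤ (g−1)² + 1`.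
  Case (b). Let `B` be an `m`-dimensional simple abelian variety, and suppose `A` is isogenous to `B^k` …
  If `m = 1` (i.e. `B` is an elliptic curve), then … `ρ(B^g) = C(g+1, 2)` (`B` has no CM), `g²` (`B` has
  CM). If `B` has CM, then `A` attains the maximal Picard number `g²`; if `B` does not have CM, then
  `ρ(A) = C(g+1, 2) ≤ 1 + (g−1)²` because `g ≥ 4`. [The case `m ≥ 2` uses Corollary 2.5 (Murty).]"

## What is formalised

For an abelian variety `A` ISOGENOUS TO A PRODUCT OF ELLIPTIC CURVES `E_{τ₀} × ⋯ × E_{τ_{g−1}}` only the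
cases (a) and (b) with `m = 1` of the printed proof arise, and both are in the tree; this file assembles
them:

* §1 `isIsomorphic_piPeriod_sumEquiv`: regrouping the factors of a finite product along
  `Fin a ⊕ Fin b ≃ Fin n` is an isomorphism `∏_k X_k ≅ (∏_{j<a} X_{e(inl j)}) × (∏_{j<b} X_{e(inr j)})`.
* §2 `IsAbelianVariety.pi`: a finite product of abelian varieties is an abelian variety.
* §3 **`finrank_neronSeveriGroup_pi_ellipticPeriod_eq_sq_or_le`**: for `g ≥ 4`,
  `ρ(E_{τ₀} × ⋯ × E_{τ_{g−1}}) = g²` or `≤ (g−1)² + 1` — case (b), `m = 1`: all curves isogenous to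
  `E_{τ₀}`, CM (`ρ = g²`, `finrank_neronSeveriGroup_pi_eq_sq`) or not (`ρ = C(g+1,2) ≤ (g−1)² + 1`,
  `IsIsogenous.finrank_neronSeveriGroup_eq_choose_of_forall_ne`); case (a): otherwise the isogeny class
  of `E_{τ₀}` and its complement split the product in two `Hom`-orthogonal blocks of dimensions
  `n, g − n ≥ 1`, so `ρ ≤ n² + (g−n)² ≤ (g−1)² + 1`; the isogeny-invariant form
  **`IsIsogenous.finrank_neronSeveriGroup_eq_sq_or_le_of_pi_ellipticPeriod`** (Thm. 1.1 (1) for every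
  abelian variety isogenous to a product of elliptic curves) and the printed "no `ρ` in the range"
  form `IsIsogenous.not_lt_finrank_neronSeveriGroup_lt_of_pi_ellipticPeriod`.

Scope: the general Theorem 1.1 (1) (an arbitrary abelian variety `A`) needs case (b) with `m ≥ 2`, i.e.
Murty's computation of `ρ(B^k)` for a simple `B` by Albert type (Prop. 2.4 / Cor. 2.5 of the source),
which the tree does not have. -- TODO(general form): Hulek–Laface Thm. 1.1 (1) for all abelian varieties.

## References

* [HulekLaface2019PicardNumbersAV] K. Hulek, R. Laface, *On the Picard numbers of abelian varieties*,
  Ann. Sc. Norm. Super. Pisa Cl. Sci. (5) XIX (2019), 1199–1224, Thm. 1.1 (1), §3.2.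
* [Lange2023AbelianVarietiesComplex] H. Lange, *Abelian Varieties over the Complex Numbers* (2023), §1.1.2
  (products of complex tori), §2.4.4 Cor. 2.4.24 (products of abelian varieties).
-/

noncomputable section

set_option maxSynthPendingDepth 3

open Module Matrix Function
open Complex (I)

namespace Literature.Geometry.Kaehler

namespace ComplexTorus

/-! ## §1 Regrouping a finite product in two blocks -/

section Split

variable {ι : Type*} [Fintype ι] [DecidableEq ι] {E : Type*} [NormedAddCommGroup E] [NormedSpace ℂ E]
  {n a b : ℕ} (Φ : Fin n → ((ι → ℝ) ≃L[ℝ] E)) (e : Fin a ⊕ Fin b ≃ Fin n)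

/-- **Regrouping the factors**: along a bijection `e : Fin a ⊕ Fin b ≃ Fin n`,
`X₀ × ⋯ × X_{n−1} ≅ (∏_{j<a} X_{e(inl j)}) × (∏_{j<b} X_{e(inr j)})` (relabel the lattice basis
`Fin n × ι ≃ (Fin a × ι) ⊕ (Fin b × ι)`, permute the coordinates of `Eⁿ`).
[cite: Lange2023AbelianVarietiesComplex, §1.1.2 (products of complex tori), p. 21] -/
theorem isIsomorphic_piPeriod_sumEquiv :
    IsIsomorphic (piPeriod Φ)
      (prodPeriod (piPeriod fun j ↦ Φ (e (Sum.inl j))) (piPeriod fun j ↦ Φ (e (Sum.inr j)))) := by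
  refine isIsomorphic_of_reindex _ _
    ((Equiv.prodCongr e.symm (Equiv.refl ι)).trans (Equiv.sumProdDistrib (Fin a) (Fin b) ι))
    ((ContinuousLinearMap.pi fun j : Fin a ↦
        (ContinuousLinearMap.proj (R := ℂ) (φ := fun _ : Fin n ↦ E) (e (Sum.inl j)))).prod
      (ContinuousLinearMap.pi fun j : Fin b ↦
        (ContinuousLinearMap.proj (R := ℂ) (φ := fun _ : Fin n ↦ E) (e (Sum.inr j)))))
    fun x ↦ ?_
  rw [prodPeriod_apply, ContinuousLinearMap.prod_apply]
  refine Prod.ext (funext fun j ↦ ?_) (funext fun j ↦ ?_)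
  · simp only [ContinuousLinearMap.pi_apply, ContinuousLinearMap.proj_apply, piPeriod_apply,
      Equiv.symm_trans_apply, Equiv.sumProdDistrib_symm_apply_left, Equiv.prodCongr_symm, Equiv.symm_symm,
      Equiv.prodCongr_apply, Prod.map_apply, Equiv.refl_symm, Equiv.refl_apply]
  · simp only [ContinuousLinearMap.pi_apply, ContinuousLinearMap.proj_apply, piPeriod_apply,
      Equiv.symm_trans_apply, Equiv.sumProdDistrib_symm_apply_right, Equiv.prodCongr_symm, Equiv.symm_symm,
      Equiv.prodCongr_apply, Prod.map_apply, Equiv.refl_symm, Equiv.refl_apply]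

end Split

/-! ## §2 A finite product of abelian varieties is an abelian variety -/

section Abelian

variable {ι : Type*} [Fintype ι] [DecidableEq ι] {E : Type*} [NormedAddCommGroup E] [NormedSpace ℂ E]

omit [DecidableEq ι] in
/-- The empty product (a point) is an abelian variety: the zero form is a Riemann form on the zero space.
[cite: Lange2023AbelianVarietiesComplex, §2.4.4 Cor. 2.4.24] -/
theorem isAbelianVariety_piPeriod_zero (Φ : Fin 0 → ((ι → ℝ) ≃L[ℝ] E)) : IsAbelianVariety (piPeriod Φ) :=
  ⟨0, fun _ _ ↦ by simp, fun _ _ ↦ ⟨0, by simp⟩, fun u hu ↦ absurd (Subsingleton.elim u 0) hu⟩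

/-- **A finite product of abelian varieties is an abelian variety** (induction along
`∏_{k≤n} X_k ≅ (∏_{k<n} X_k) × X_n` with Cor. 2.4.24 for two factors, `IsAbelianVariety.prod`).
[cite: Lange2023AbelianVarietiesComplex, §2.4.4 Cor. 2.4.24] -/
theorem IsAbelianVariety.pi : ∀ {n : ℕ} {Φ : Fin n → ((ι → ℝ) ≃L[ℝ] E)},
    (∀ k, IsAbelianVariety (Φ k)) → IsAbelianVariety (piPeriod Φ)
  | 0, Φ, _ => isAbelianVariety_piPeriod_zero Φ
  | n + 1, Φ, h => (isIsomorphic_piPeriod_succ Φ).isAbelianVariety_iff.2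
      ((IsAbelianVariety.pi fun k ↦ h k.castSucc).prod (h (Fin.last n)))

end Abelian

/-! ## §3 Hulek–Laface Thm. 1.1 (1) for products of elliptic curves -/

section Gap

/-- `C(g+1, 2) ≤ (g−1)² + 1` for `g ≥ 4` ("because `g ≥ 4`"). [cite: HulekLaface2019PicardNumbersAV, §3.2 case (b)] -/
theorem choose_succ_two_le_sq_pred_add_one {g : ℕ} (hg : 4 ≤ g) : (g + 1).choose 2 ≤ (g - 1) ^ 2 + 1 := by
  obtain ⟨c, rfl⟩ := Nat.exists_eq_add_of_le hg
  rw [Nat.choose_two_right]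
  apply Nat.div_le_of_le_mul
  have h1 : 4 + c + 1 - 1 = c + 4 := by omega
  have h2 : 4 + c - 1 = c + 3 := by omega
  rw [h1, h2]
  nlinarith

variable {g : ℕ} {τ : Fin g → ℂ} (hτ : ∀ k, 0 < (τ k).im)

/-- **Hulek–Laface 2019, Thm. 1.1 (1) for a product of `g ≥ 4` elliptic curves:
`ρ(E_{τ₀} × ⋯ × E_{τ_{g−1}}) = g²` or `ρ ≤ (g−1)² + 1`.** Proof as printed (§3.2): if every `E_{τ_k}` is
isogenous to `E_{τ₀}` (case (b), `m = 1`) then `ρ = g²` when `E_{τ₀}` has complex multiplication and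
`ρ = C(g+1, 2) ≤ (g−1)² + 1` otherwise; if not (case (a)), the isogeny class of `E_{τ₀}` among the factors
and its complement regroup the product as `A_1 × A_2` with `Hom(A_2, A_1) = 0`, `dim A_1 = n`,
`dim A_2 = g − n`, `1 ≤ n ≤ g − 1`, whence `ρ ≤ n² + (g−n)² ≤ (g−1)² + 1`.
[cite: HulekLaface2019PicardNumbersAV, Thm. 1.1 (1) and §3.2 (cases (a), (b) with `m = 1`)] -/
theorem finrank_neronSeveriGroup_pi_ellipticPeriod_eq_sq_or_le (hg : 4 ≤ g) :
    finrank ℤ (neronSeveriGroup (piPeriod fun k ↦ ellipticPeriod (hτ k).ne')) = g ^ 2 ∨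
      finrank ℤ (neronSeveriGroup (piPeriod fun k ↦ ellipticPeriod (hτ k).ne')) ≤ (g - 1) ^ 2 + 1 := by
  classical
  have hg0 : 0 < g := by omega
  set k₀ : Fin g := ⟨0, hg0⟩
  by_cases hall : ∀ k, IsIsogenous (ellipticPeriod (hτ k).ne') (ellipticPeriod (hτ k₀).ne')
  · -- case (b), `m = 1`: `A ∼ E_{τ₀}^g`
    by_cases hCM : ∃ a b : ℚ, τ k₀ ^ 2 + a * τ k₀ + b = 0
    · obtain ⟨a, b, hq⟩ := hCM
      exact Or.inl (finrank_neronSeveriGroup_pi_eq_sq (Φ := fun k ↦ ellipticPeriod (hτ k).ne')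
        (hτ := (hτ k₀).ne') hall hq)
    · push Not at hCM
      refine Or.inr ?_
      rw [(IsIsogenous.pi_powPeriod hall).finrank_neronSeveriGroup_eq_choose_of_forall_ne _ (hτ k₀).ne' g hCM]
      exact choose_succ_two_le_sq_pred_add_one hg
  · -- case (a): split along the isogeny class of `E_{τ₀}`
    push Not at hall
    obtain ⟨k₁, hk₁⟩ := hall
    refine Or.inr ?_
    let p : Fin g → Prop := fun k ↦ IsIsogenous (ellipticPeriod (hτ k).ne') (ellipticPeriod (hτ k₀).ne')
    let e : Fin (Fintype.card {k // p k}) ⊕ Fin (Fintype.card {k // ¬ p k}) ≃ Fin g :=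
      ((Fintype.equivFin {k // p k}).symm.sumCongr (Fintype.equivFin {k // ¬ p k}).symm).trans
        (Equiv.sumCompl p)
    have ha : 0 < Fintype.card {k // p k} := Fintype.card_pos_iff.2 ⟨⟨k₀, IsIsogenous.refl _⟩⟩
    have hb : 0 < Fintype.card {k // ¬ p k} := Fintype.card_pos_iff.2 ⟨⟨k₁, hk₁⟩⟩
    have hab : Fintype.card {k // p k} + Fintype.card {k // ¬ p k} = g := by
      rw [← Fintype.card_sum, Fintype.card_congr (Equiv.sumCompl p), Fintype.card_fin]
    have hiso := isIsomorphic_piPeriod_sumEquiv (fun k ↦ ellipticPeriod (hτ k).ne') e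
    have hA : IsAbelianVariety (piPeriod fun j : Fin (Fintype.card {k // p k}) ↦
        ellipticPeriod (hτ (e (Sum.inl j))).ne') :=
      IsAbelianVariety.pi fun j ↦ isAbelianVariety_elliptic (hτ _)
    have hHom : homRat (piPeriod fun j : Fin (Fintype.card {k // ¬ p k}) ↦ ellipticPeriod (hτ (e (Sum.inr j))).ne')
        (piPeriod fun j : Fin (Fintype.card {k // p k}) ↦ ellipticPeriod (hτ (e (Sum.inl j))).ne') = ⊥ := by
      refine (homRat_pi_left_eq_bot_iff _ _).2 fun j ↦ (homRat_pi_right_eq_bot_iff _ _).2 fun j' ↦ ?_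
      refine (isSimple_ellipticPeriod _).homRat_eq_bot (isSimple_ellipticPeriod _) fun h ↦ ?_
      have h1 : p (e (Sum.inl j')) := by
        simp only [e, Equiv.trans_apply, Equiv.sumCongr_apply, Sum.map_inl, Equiv.sumCompl_apply_inl]
        exact ((Fintype.equivFin {k // p k}).symm j').2
      have h2 : ¬ p (e (Sum.inr j)) := by
        simp only [e, Equiv.trans_apply, Equiv.sumCongr_apply, Sum.map_inr, Equiv.sumCompl_apply_inr]
        exact ((Fintype.equivFin {k // ¬ p k}).symm j).2
      exact h2 (IsIsogenous.trans (h₁ := h) (h₂ := h1))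
    have hda : finrank ℂ (Fin (Fintype.card {k // p k}) → ℂ) = Fintype.card {k // p k} := by simp
    have hdb : finrank ℂ (Fin (Fintype.card {k // ¬ p k}) → ℂ) = Fintype.card {k // ¬ p k} := by simp
    have := hiso.isIsogenous.finrank_neronSeveriGroup_le_sq_pred_add_one hA hHom (by rw [hda]; exact ha)
      (by rw [hdb]; exact hb)
    rwa [hda, hdb, hab] at this

/-- **Hulek–Laface 2019, Thm. 1.1 (1) for abelian varieties isogenous to a product of elliptic curves**:
if `A ∼ E_{τ₀} × ⋯ × E_{τ_{g−1}}` with `g ≥ 4`, then `ρ(A) = g²` or `ρ(A) ≤ (g−1)² + 1` (`ρ` is an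
isogeny invariant). [cite: HulekLaface2019PicardNumbersAV, Thm. 1.1 (1) and §3.2] -/
theorem IsIsogenous.finrank_neronSeveriGroup_eq_sq_or_le_of_pi_ellipticPeriod {ι : Type*} [Fintype ι]
    [DecidableEq ι] {E : Type*} [NormedAddCommGroup E] [NormedSpace ℂ E] {Ψ : (ι → ℝ) ≃L[ℝ] E}
    (hΨ : IsIsogenous Ψ (piPeriod fun k ↦ ellipticPeriod (hτ k).ne')) (hg : 4 ≤ g) :
    finrank ℤ (neronSeveriGroup Ψ) = g ^ 2 ∨ finrank ℤ (neronSeveriGroup Ψ) ≤ (g - 1) ^ 2 + 1 := by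
  rw [hΨ.finrank_neronSeveriGroup_eq Ψ _]
  exact finrank_neronSeveriGroup_pi_ellipticPeriod_eq_sq_or_le hτ hg

/-- **Thm. 1.1 (1) in the printed form, for `A ∼ E_{τ₀} × ⋯ × E_{τ_{g−1}}`, `g ≥ 4`: the Picard number
is NOT in the range `(g−1)² + 1 < ρ < g²`.** [cite: HulekLaface2019PicardNumbersAV, Thm. 1.1 (1)] -/
theorem IsIsogenous.not_lt_finrank_neronSeveriGroup_lt_of_pi_ellipticPeriod {ι : Type*} [Fintype ι]
    [DecidableEq ι] {E : Type*} [NormedAddCommGroup E] [NormedSpace ℂ E] {Ψ : (ι → ℝ) ≃L[ℝ] E}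
    (hΨ : IsIsogenous Ψ (piPeriod fun k ↦ ellipticPeriod (hτ k).ne')) (hg : 4 ≤ g) :
    ¬ ((g - 1) ^ 2 + 1 < finrank ℤ (neronSeveriGroup Ψ) ∧ finrank ℤ (neronSeveriGroup Ψ) < g ^ 2) := by
  rcases hΨ.finrank_neronSeveriGroup_eq_sq_or_le_of_pi_ellipticPeriod hτ hg with h | h <;> omega

/-- The same for the product itself: `ρ(E_{τ₀} × ⋯ × E_{τ_{g−1}}) ∉ ((g−1)² + 1, g²)` for `g ≥ 4`.
[cite: HulekLaface2019PicardNumbersAV, Thm. 1.1 (1)] -/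
theorem not_lt_finrank_neronSeveriGroup_pi_ellipticPeriod_lt (hg : 4 ≤ g) :
    ¬ ((g - 1) ^ 2 + 1 < finrank ℤ (neronSeveriGroup (piPeriod fun k ↦ ellipticPeriod (hτ k).ne')) ∧
        finrank ℤ (neronSeveriGroup (piPeriod fun k ↦ ellipticPeriod (hτ k).ne')) < g ^ 2) := by
  rcases finrank_neronSeveriGroup_pi_ellipticPeriod_eq_sq_or_le hτ hg with h | h <;> omega

end Gap

end ComplexTorus

end Literature.Geometry.Kaehler

end
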